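import Summits.ValiantsHypothesis.ValiantsHypothesis.Cruxes.DualUnipotentThreeHalves.Lines.radical_split
import Summits.ValiantsHypothesis.ValiantsHypothesis.Theorems.GrenetZeonDualUnipotentThreeHalvesHeavyTopIndexCore
import Summits.ValiantsHypothesis.ValiantsHypothesis.Theorems.GrenetZeonDualUnipotentThreeHalvesSlowCoreAbsorb
import Summits.ValiantsHypothesis.ValiantsHypothesis.Theorems.GrenetZeonDualUnipotentThreeHalvesSlowCoreDefs
import Summits.ValiantsHypothesis.ValiantsHypothesis.Theorems.GrenetZeonDualUnipotentThreeHalvesSlowCoreGlue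

/-!
# LINE `slow_core` REV 2 = THE MASS CUT (successor of the dead line α `krylov_seed`) — crux `GrenetZeon.DualUnipotentThreeHalves`
# (stmt-ValiantsHypothesis-24318); target S3 `SlowPlane` ⇒ R2ᵖ `HeavyTopSlowLaw` ⇒ crux, POWER currency (director-valiant R305–R307, R315 (1)(3), R319)
# REGISTERED STUB (rev 3): `stub_longMassSlowLawInv` (research).  GLUE, (b₀) `ShortMassLedger0` and ABSORB are PROVED (kernel).

Drafted by the LEAD PROVER val-port-2 g3 (α lead by lineage; α DEAD on paper R304, `Lines/krylov_seed_dead.md` @06379e82cda3) on the director's ORDER,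
from two admitted design inputs: #1 val-idea-26 g4's INDEX SANDWICH (✓ p670964 `…HeavyTopIndexCore`: necessary ✓ `pow_eq_zero_of_wordTame`, sufficient
✓ `flagCheap_of_indexCore`; `IndexCoreLaw` typed on the irreducible locus) and #2 val-idea-31 g4's POWER-CURRENCY observation (val-width 22:09:46Z, second
leg val-htc-lead 22:13:31Z): the node the crux CONSUMES is S3 `SlowPlane` of line #1 (`radical_split`), which uses ONLY `N^{n−1}`; the ratio knapsack
`E(n) = U_{p,k} ⊕ B_{⌊√n⌋}(𝔫_d)` (val-idea-30 g3) that kills every common-ratio word/flag/weight SUFFICIENT condition (C⁺, S3b, R2-as-typed — the last CONTESTED,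
R307 (1)) is SLOW with the TRIVIAL certificate (`X^h = 0` on `U_{h,k}` — ✓ `Negative/InflatedReturnsGeneral.infl_pow_eq_zero` for every `h ≥ 3` — so
`K := N_lin⁻¹(U ⊕ 0)`, `k := 0`).  Critic of record: val-idea-crit-7 g3 (by lineage); NOT registered until the critic has priced it (R305 (2)).

HEAD.  R2ᵖ `HeavyTopSlowLaw` := R2's hypotheses (regime `C₀m² < n³`, affine, `N^m = 0`, heavy-top: every `RadOrth` direction space has
`finrank ≤ 16m√n + 16n`) with CONCLUSION `Slow n m N` (the body of S3: some `K, k` with `(k+1)·n < dim K` along which every entry of `N(x+sv)^{n−1}` has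
`s`-degree `≤ k`).  R2 ⇒ R2ᵖ by ✓ `runBound` (`heavyTopSlowLaw_of_heavyTopLaw`); the converse fails («slow only by cancellation»), which is the point.
COMPOSITION (kernel, no `sorry` outside `stub_*`): `slowPlane_of_split : RadicalCoarsening → HeavyTopSlowLaw → SlowPlane` (case split on a large `RadOrth K`:
R1 ✓ p623799 + ✓ `runBound`; else R2ᵖ) and ★ `dualUnipotentThreeHalves_of : HeavyTopSlowLaw → DualUnipotentThreeHalves` (S1 ✓, S2 ✓ GMS fact discharged,
`dualUnipotentThreeHalves_of_slowPlane`).  So the crux follows from R2ᵖ ALONE, by name.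

THE REV-1 SPLIT of R2ᵖ (R306 (3); SUPERSEDED by the MASS CUT of rev 2 below — kept as history and as corollary defs):
* IRR  `IrrSlowLaw` (rev 1: `stub_irrSlowLaw`) — R2ᵖ on the IRREDUCIBLE locus `pencilAlg N = ⊤` (research, WORKED FIRST).  Route of record: idea-26's
  `IndexCoreLaw` (✓ typed) ⇒ `FlagCheap` (✓ `flagCheap_of_indexCoreLaw`) ⇒ `Slow` (✓ `runBound`) — `irrSlowLaw_of_indexCoreLaw` below, kernel;
  so IRR ⟸ `IndexCoreLaw`, and IRR is weaker (power currency).  No counter-candidate known (E(n) is reducible; W(T_p) is index-cheap).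
* ABSORB `stub_absorb : AbsorbLemma` — idea-31 g4 (3), PER-AGNOSTIC, M-sized, PROVED (rev 1): a pointwise-SHORT block costs `+h` ADDITIVELY per absorbed
  constituent along a chain (no ratio, no freezing; crit-7 g3 V25 P-A2: per constituent, NOT per tower — RED carries a ledger) — for a
  block-upper one-variable polynomial matrix `M = [[A, G],[0, B]]` with `A^h = 0` and affine (degree ≤ 1) entries, `deg_s (M^L)_{ij} ≤ h + max_{b ≤ L}
  deg_s (B^b)`; so the ratio knapsack does not lift to powers.  CURRENCY CAVEAT (V25 P-A1): bare `Slow` (only the `(n−1)`-st power) does NOT absorb —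
  witness `[[0,1],[0,s·J_{n−1}]]` — the induction runs in WINDOW currency `SlowR` (all powers `b ≤ n−1`, below; free from `FlagCheap` by
  `slowR_of_flagCheap`; E(n) ⊨ `SlowR` with `k = h−1`, `Slow` with `k = 0`).  Typed here at the matrix level (no pencil, no flag); it is the first ingredient of RED's planned cut and the kernel reason E(n) is slow.
* RED `RedSlowLaw` (rev 1: `stub_redSlowLaw`) — R2ᵖ on the REDUCIBLE heavy-top locus `pencilAlg N ≠ ⊤` (research, PARKED — no prover works it until crit-7 g3
  prices the cut).  PLANNED L4 CUT (not registered tonight; needs block extraction in the kernel): Jordan–Hölder block form (✓ `exists_block_conj` /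
  ✓ `exists_fat_irreducible_block`), ABSORB the pointwise-short blocks (`h ≤ H`) by induction on `m` (the regime and nilpotency descend to diagonal
  blocks; heavy-top does NOT, so the induction runs on S3's body with R1 ✓ re-dispatching the `RadOrth`-large sub-blocks), leaving RED-LONG = «every JH
  block LONG (pointwise nilindex `> H`) and COORDINATE-DENSE» — idea-31 g4 (4)'s enemy portrait; U-type long blocks freeze at codim `< n/C₀`.
  FIRST TEST ROW (decided, paper + kernel pieces): E(n) — RED holds there with `k = 0` (htc-lead 22:13:31Z), and idea-26 g4's two-sided index statement
  for E(n) is the docstring datum of RED-LONG.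
GLUE `heavyTopSlowLaw_of : IrrSlowLaw → RedSlowLaw → HeavyTopSlowLaw` (excluded middle on `pencilAlg N = ⊤`).  ABSORB does not enter today's glue: it is
registered because the RED cut is stated through it (R306 (3): «replaces most of RED-DAG») and because it is independently citable (E(n), census rows).

REV 1 (registration rev; crit-7 g3 V25 = REGISTRATION PASS @040860f75b4c, V26 @ea3cc7c3d4c1): `stub_absorb` CLOSED BY NAME (✓ p674864); E1 `SlowR` +
`slow_of_slowR` + `slowR_of_flagCheap` added (window currency, kernel); E2/E3 wording; V26 (c1): IRR's INDEX FEEDER `IndexCoreLaw` is DEAD ON PAPER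
(val-idea-29 g5's invisible coupling E♮(n), `Cruxes/…/InvisibleCoupling.lean`, law's author val-idea-26 g5 concurs) — `irrSlowLaw_of_indexCoreLaw` stays as
kernel wiring with a dead antecedent, IRR is an UNFED research stub (enemy list EMPTY in power currency; first irreducible test row E♮: `SlowR`, `k ≤ 2h−2`);
(c2): the em-cut `pencilAlg N = ⊤ / ≠ ⊤` is valid glue but no longer separates difficulty — the next planning act (rev 2 or a sibling) is the MASS CUT
(pointwise-SHORT mass: ledger, tier M/L, provable — vs LONG dense mass: research; V25 §3, V26 §7.3).
REV 2 (THE MASS CUT = main line; director-valiant g17 R315 (3), crit-7 g3 V27 = PASS @bfe941d3064b, typing pen val-idea-26 g5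
`Cruxes/DualUnipotentThreeHalves/MassCut.lean` rev 4 @09b6fd968480 sha16 23f6eb4e7502b32a (E27 edits) — defs `linEntry … MassCutGlue` restated
δ-VERBATIM below because crux workfiles are not importable on the farm):
the em-cut IRR | RED is SUPERSEDED as the registered split (kept as corollary defs) by
* (b₀) `ShortMassLedger0` — the LEVEL-STACK law in WINDOW currency, a = 0 form (the one the assembly uses): per-level ledgers `kb p` on a common `K`
  stack to `Σ kb + (P − 1)` — PROVED IN-FILE (`shortMassLedger0_holds`, from ✓ `SlowCore.absorb_chain_uniform`, rev 3 of `…SlowCoreAbsorb`);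
* (c) `stub_longMassSlowLaw : LongMassSlowLaw` — THE ONE RESEARCH STATEMENT (mass-relative PRICE `≤ c·√n·b` for every IRREDUCIBLE constituent of
  size `b`; `∃ c`, no hand-picked constant; NOT weaker than S3 — stronger than S3|Irr by design, the induction-friendly form, V27 (q1); enemy =
  Q-RED-2 proper, 0 known members; 0 provers head-on);
* (g) `stub_massCutGlue : MassCutGlue` — `ShortMassLedger0 → LongMassSlowLaw → SlowPlane` (M/L, PROVABLE: composition series + one constant
  conjugation (✓ `exists_block_conj`), Burnside for the diagonal constituents, conj-invariance of `Slow` ✓, constituent `RelCert` ↔ class `Ledger`,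
  class freeze, a = 0 stack ✓, arithmetic `C₀ = (c+14)²` — V27 (q3) debt list (g1)–(g6));
HEAD unchanged in substance: `SlowPlane` (S3) ⇒ R2ᵖ `HeavyTopSlowLaw` (`heavyTopSlowLaw_of_slowPlane`) ⇒ IRR/RED as corollaries; crux BY NAME via
`dualUnipotentThreeHalves_of_massCut`.  The DEFORMATION cut (`RedDeformsToIrr`, `SlowClosedAlongCurves`; MassCut.lean §6) is the typed FALLBACK sibling,
NOT armed.  `sorry` occurs ONLY in `stub_longMassSlowLaw` and `stub_massCutGlue`.
REV 3 (lead, 2026-08-29T00:1xZ): THE GLUE IS PROVED IN THE KERNEL (PART A, ≈ 760 sorry-free lines, namespace `…SlowCoreGlue`, = the Theorems files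
`…SlowCoreLedger` p680269 + staged `…SlowCoreCoarsen` / `…SlowCoreGlue`): `Summit.ValiantsHypothesis.ValiantsHypothesis.Theorems.GrenetZeon.SlowCore.slow_of_longMassSlowLawInv : LongMassSlowLawInv → (S3 body)`, hence
`massCutGlueInv_holds : MassCutGlueInv` and `slowPlane_of_longMassSlowLawInv`.  To keep BURNSIDE out of the kernel, stub (c) is RE-KEYED to the
invariant-subspace form `stub_longMassSlowLawInv : Summit.ValiantsHypothesis.ValiantsHypothesis.Theorems.GrenetZeon.SlowCore.LongMassSlowLawInv` (val-idea-26 g5 E27-3 option, named in V27's debt list (g2):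
«or stub (c) as `LongMassSlowLawInv` and skip it»; equivalent to the `pencilAlg = ⊤` form on paper).  REGISTERED STUBS (rev 3/4): {`stub_longMassSlowLawInv`} —
`sorry` occurs ONLY there (sorries 1).  `stub_massCutGlue`/`stub_longMassSlowLaw` of rev 2 are retired (`MassCutGlue`, `LongMassSlowLaw` stay as defs).
REV 4: PART A replaced by `import …SlowCoreGlue` (✓ p680269/p680554/p680768 landed 00:00–00:08Z); the stub is keyed to `SlowCore.LongMassSlowLawInv` BY NAME.
HONEST FRAMING: a skeleton (sorries 1 = the LongMass research law).  Nothing here proves R2ᵖ, IRR, RED, R2, S3, the crux 24318, 8062 or `VP ≠ VNP` — all OPEN / NOT proved;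
R2 as typed (`HeavyTopLaw`, conclusion `FlagCheap`) is CONTESTED on paper (idea-30 g3 §6.3, one leg; R307 (1)) and is NOT used below except as the
antecedent of `heavyTopSlowLaw_of_heavyTopLaw`; R2 as typed and the index feeders (`IndexCoreLaw`, `NilCoreLaw`, `ThinReturnLawIrr`, `DenseRatioLaw`) are DEAD ON
PAPER (R319 (1)).  (Rev-1 history: `sorry` was in `stub_irrSlowLaw` / `stub_redSlowLaw`; both are now corollary DEFS without stubs — `IrrSlowLaw`, `RedSlowLaw`
follow from R2ᵖ, hence from S3.)
-/

set_option linter.dupNamespace false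
set_option autoImplicit false

noncomputable section

/-! # PART A — THE GLUE KERNEL: ✓ LANDED Theorems-side (p680269 `…SlowCoreLedger`, p680554 `…SlowCoreCoarsen`, p680768 `…SlowCoreGlue`), imported;
rev 3 carried an inlined copy.  `SlowCore.slow_of_longMassSlowLawInv : SlowCore.LongMassSlowLawInv → (S3 body)` is the kernel glue. -/

/-! # PART B — THE LINE -/

namespace Summit.ValiantsHypothesis.ValiantsHypothesis.Cruxes.DualUnipotentThreeHalves.SlowCoreLine

open MvPolynomial Matrix
open scoped BigOperators
open Summit.ValiantsHypothesis.ValiantsHypothesis.Cruxes.TwoDimCoefficients.DimTwoCases (AffMat IsAffine)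
open Summit.ValiantsHypothesis.ValiantsHypothesis.Cruxes.DualUnipotentThreeHalves.RadicalSplit
  (lineSubst totalDegree_lineSubst_le_one FlagCheap RadOrth pencilAlg RadicalCoarsening HeavyTopLaw SlowPlane RunBound runBound_proof
   stub_radicalCoarsening stub_permRank_of_lineFlat stub_gms dualUnipotentThreeHalves_of_slowPlane)
open Summit.ValiantsHypothesis.ValiantsHypothesis.Theses.GrenetZeon (DualUnipotentThreeHalves)

/-! ## Objects (power currency) -/

/-- **`Slow n m N`** — the body of S3 `SlowPlane` for ONE pencil: a direction space `K` and an order `k` with `(k+1)·n < dim K` such that along every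
line `x + s·v`, `v ∈ K`, every entry of `N(x + s v)^{n−1}` has `s`-degree `≤ k`.  (val-idea-31 g4 (2); R306 (2).) -/
def Slow (n m : ℕ) (N : AffMat n m) : Prop :=
  ∃ (K : Submodule ℂ (Fin n × Fin n → ℂ)) (k : ℕ),
    (∀ x v : Fin n × Fin n → ℂ, v ∈ K → ∀ i j : Fin m, (((N.map (lineSubst x v)) ^ (n - 1)) i j).totalDegree ≤ k) ∧
    (k + 1) * n < Module.finrank ℂ K

/-- **`SlowR n m N`** — WINDOW currency (crit-7 g3 V25 E1/P-A1): like `Slow` but bounding EVERY power `b ≤ n − 1` along the lines of `K`.  This is the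
currency in which absorption inducts (bare `Slow` does not absorb); it is free from `FlagCheap` (`slowR_of_flagCheap`) and implies `Slow`
(`slow_of_slowR`).  E(n) ⊨ `SlowR` with `k = h − 1`. -/
def SlowR (n m : ℕ) (N : AffMat n m) : Prop :=
  ∃ (K : Submodule ℂ (Fin n × Fin n → ℂ)) (k : ℕ),
    (∀ x v : Fin n × Fin n → ℂ, v ∈ K → ∀ b, b ≤ n - 1 → ∀ i j : Fin m, (((N.map (lineSubst x v)) ^ b) i j).totalDegree ≤ k) ∧
    (k + 1) * n < Module.finrank ℂ K

/-- `SlowR ⇒ Slow` (take `b = n − 1`). -/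
theorem slow_of_slowR {n m : ℕ} {N : AffMat n m} (h : SlowR n m N) : Slow n m N := by
  obtain ⟨K, k, hK, hdim⟩ := h
  exact ⟨K, k, fun x v hv i j => hK x v hv (n - 1) le_rfl i j, hdim⟩

/-- Potential bookkeeping for EVERY power `b ≤ n − 1` (✓ `FlagCost.coeff_pow_of_flagAdapted` is already uniform in the exponent). -/
theorem totalDegree_pow_le_flagDeg_of_le {m : ℕ} (lvl : Fin m → ℕ) (p r a n b : ℕ) (hb : b ≤ n - 1) (hl : ∀ i, lvl i < p)
    (M : Matrix (Fin m) (Fin m) (MvPolynomial (Fin 1) ℂ))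
    (h : ∀ (i j : Fin m) (d : Fin 1 →₀ ℕ), coeff d (M i j) ≠ 0 → (a + 1) * d 0 + lvl j ≤ lvl i + r) (i j : Fin m) :
    ((M ^ b) i j).totalDegree ≤ (p - 1 + r * (n - 1)) / (a + 1) := by
  rw [totalDegree]
  refine Finset.sup_le fun d hd => ?_
  have hne : coeff d ((M ^ b) i j) ≠ 0 := mem_support_iff.mp hd
  have e := Summit.ValiantsHypothesis.ValiantsHypothesis.Theorems.GrenetZeon.FlagCost.coeff_pow_of_flagAdapted lvl r a M h b i j d hne
  have hsum : (d.sum fun _ e => e) = d 0 := by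
    rw [Finsupp.sum_fintype _ _ (fun _ => rfl)]
    simp
  rw [hsum]
  rw [Nat.le_div_iff_mul_le (Nat.succ_pos a), mul_comm]
  have hi := hl i
  have hrb : r * b ≤ r * (n - 1) := Nat.mul_le_mul_left _ hb
  generalize (a + 1) * d 0 = A at e ⊢
  generalize r * (n - 1) = B at e hrb ⊢
  generalize r * b = B' at e hrb
  omega

/-- **`FlagCheap ⇒ SlowR`** (the run bound ✓ `FlagCost.runBound` for every power `b ≤ n − 1`; same flag, same `K`, same budget). -/
theorem slowR_of_flagCheap {n m : ℕ} (N : AffMat n m) (h : FlagCheap n m N) : SlowR n m N := by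
  obtain ⟨K, k, hadapt, hdim⟩ := h
  refine ⟨K, k, ?_, hdim⟩
  intro x v hv b hb i j
  obtain ⟨g, lvl, p, r, a, hl, hk, hA⟩ := hadapt x v hv
  set N' := N.map (lineSubst x v) with hN'
  set G : Matrix (Fin m) (Fin m) (MvPolynomial (Fin 1) ℂ) := (g : Matrix (Fin m) (Fin m) ℂ).map C with hG
  set G' : Matrix (Fin m) (Fin m) (MvPolynomial (Fin 1) ℂ) := (↑g⁻¹ : Matrix (Fin m) (Fin m) ℂ).map C with hG'
  have hGG : G' * G = 1 := by
    rw [hG, hG', ← Matrix.map_mul, Units.inv_mul, Matrix.map_one _ C_0 C_1]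
  have hdegA : ∀ a' b', (((G * N' * G') ^ b) a' b').totalDegree ≤ k := fun a' b' =>
    (totalDegree_pow_le_flagDeg_of_le lvl p r a n b hb hl _ hA a' b').trans hk
  have hconj : N' ^ b = G' * (G * N' * G') ^ b * G :=
    (Summit.ValiantsHypothesis.ValiantsHypothesis.Theorems.GrenetZeon.FlagCost.conj_pow_eq G G' N' hGG b).symm
  rw [hconj]
  exact Summit.ValiantsHypothesis.ValiantsHypothesis.Theorems.GrenetZeon.FlagCost.totalDegree_conj_le
    (g : Matrix (Fin m) (Fin m) ℂ) (↑g⁻¹ : Matrix (Fin m) (Fin m) ℂ) ((G * N' * G') ^ b) hdegA i j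

/-- **R2ᵖ — HEAVY-TOP SLOW LAW** (the HEAD; LAW tier): below `C₀m² < n³`, an affine nilpotent pencil all of whose trace-orthogonal direction spaces
are small is SLOW.  R2 `HeavyTopLaw` ⇒ R2ᵖ (✓ `runBound`); E(n) satisfies R2ᵖ's conclusion with `k = 0` (so the ratio knapsack is not a
counter-candidate); a counter-candidate must be LONG ∧ COORDINATE-DENSE ∧ ratio-forcing (idea-31 g4 (4)).  ADMITTED FOR PRICING (R306 (2)) — crit-7 g3
prices the costume question first (it quantifies over all heavy-top pencils of the format; S3 is one pencil). -/
def HeavyTopSlowLaw : Prop :=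
  ∃ C₀ n₀ : ℕ, ∀ n ≥ n₀, ∀ m : ℕ, C₀ * m ^ 2 < n ^ 3 → ∀ N : AffMat n m, IsAffine N → N ^ m = 0 →
    (∀ K : Submodule ℂ (Fin n × Fin n → ℂ), RadOrth n m N K →
      Module.finrank ℂ K ≤ 16 * m * Nat.sqrt n + 16 * n) →
    Slow n m N

/-- **IRR — R2ᵖ on the IRREDUCIBLE locus** (`pencilAlg N = ⊤`; research stub #1, worked).  Kernel wiring `irrSlowLaw_of_indexCoreLaw` from
idea-26's typed `IndexCoreLaw` — whose antecedent is DEAD ON PAPER since V26 (idea-29 g5's irreducible invisible coupling E♮(n) is ¬FlagCheap, hence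
¬IndexCoreLaw / ¬NilCoreLaw / ¬(R2 | pencilAlg = ⊤); E♮ itself is `SlowR` with `k ≤ 2h−2`, so IRR is untouched): an UNFED research stub, enemy list
EMPTY in power currency (crit-7 g3 V26 (c1)). -/
def IrrSlowLaw : Prop :=
  ∃ C₀ n₀ : ℕ, ∀ n ≥ n₀, ∀ m : ℕ, C₀ * m ^ 2 < n ^ 3 → ∀ N : AffMat n m, IsAffine N → N ^ m = 0 →
    (∀ K : Submodule ℂ (Fin n × Fin n → ℂ), RadOrth n m N K →
      Module.finrank ℂ K ≤ 16 * m * Nat.sqrt n + 16 * n) →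
    pencilAlg N = ⊤ → Slow n m N

/-- **RED — R2ᵖ on the REDUCIBLE locus** (`pencilAlg N ≠ ⊤`; research stub #3, PARKED — no prover before the critic un-parks it: conditions U1 ledger `def`
in `SlowR` currency + induction step, U2 IRR-relative statement typed with rows E(n)/U-towers/W(T_p), U3 density–index bound Q-RED-1 cited or typed;
crit-7 g3 V25 (q3)).  Price of record: RED = S3 ∖ IRR verbatim, tier = S3's; constituent certificates must glue on a COMMON `K` (codims add, mass shared,
degrees add `+kᵢ` along chains — `AbsorbLemma` / idea-31's `totalDegree_pow_triu_le`), so RED-LONG needs a MASS-RELATIVE law ⊋ `IrrSlowLaw`.  PORTRAIT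
(V25 §4): heavy-top ⇒ non-pattern; enemy = large semisimple head + a constituent in Q-RED-1 (short dense irreducible non-U) ∪ Q-RED-2 (long dense irreducible
without short core) with no affordable ledger — zero known members.  ROWS: E(n) ⊨ `Slow` (k = 0) and `SlowR` (k = h−1) (htc-lead / idea-28 / idea-31 legs,
✓ `infl_pow_eq_zero`); idea-26 g4/g5's two-sided index statement for E(n) is this stub's docstring datum only (R307 (3)). -/
def RedSlowLaw : Prop :=
  ∃ C₀ n₀ : ℕ, ∀ n ≥ n₀, ∀ m : ℕ, C₀ * m ^ 2 < n ^ 3 → ∀ N : AffMat n m, IsAffine N → N ^ m = 0 →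
    (∀ K : Submodule ℂ (Fin n × Fin n → ℂ), RadOrth n m N K →
      Module.finrank ℂ K ≤ 16 * m * Nat.sqrt n + 16 * n) →
    pencilAlg N ≠ ⊤ → Slow n m N

/-- **ABSORB — the absorption lemma** (idea-31 g4 (3); per-agnostic, M-sized, stub #2): for a one-variable polynomial matrix `M` that is block-upper
for a two-valued cut `top : Fin m → Prop` (entries from a bottom column into a top row vanish … i.e. `M i j = 0` whenever `¬ top i` and `top j`), whose
TOP diagonal block is pointwise short (`(M^h) i j = 0` for `top i`, `top j` — equivalently `A^h = 0` for the top block `A`, since powers of a block-upper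
matrix have the powers of the diagonal blocks on the diagonal), whose entries have `s`-degree `≤ 1`, and whose BOTTOM block powers `M^b`, `b ≤ L`, have
entries of degree `≤ k` on the bottom block, EVERY entry of `M^L` has degree `≤ k + h`.  (Paths through the block-upper matrix spend `≤ h − 1` steps in the
top block — else they vanish — one step in the glue and the rest in the bottom block.) -/
def AbsorbLemma : Prop :=
  ∀ (m : ℕ) (top : Fin m → Prop) [DecidablePred top] (M : Matrix (Fin m) (Fin m) (MvPolynomial (Fin 1) ℂ)) (h k L : ℕ),
    (∀ i j, ¬ top i → top j → M i j = 0) →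
    (∀ i j, top i → top j → (M ^ h) i j = 0) →
    (∀ i j, (M i j).totalDegree ≤ 1) →
    (∀ b, b ≤ L → ∀ i j, ¬ top i → ¬ top j → ((M ^ b) i j).totalDegree ≤ k) →
    ∀ i j, ((M ^ L) i j).totalDegree ≤ k + h

/-! ### By-name identification with the Theorems twin ✓ p677282 `…SlowCoreDefs` (same bodies; the two `lineSubst`s are `rfl`-equal) -/

/-- `Slow` here IS `SlowCore.Slow` of ✓ `Theorems/…SlowCoreDefs.lean`. -/
theorem slow_iff_byName {n m : ℕ} (N : AffMat n m) :
    Slow n m N ↔ Summit.ValiantsHypothesis.ValiantsHypothesis.Theorems.GrenetZeon.SlowCore.Slow n m N := Iff.rfl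

/-- `SlowR` here IS `SlowCore.SlowR`. -/
theorem slowR_iff_byName {n m : ℕ} (N : AffMat n m) :
    SlowR n m N ↔ Summit.ValiantsHypothesis.ValiantsHypothesis.Theorems.GrenetZeon.SlowCore.SlowR n m N := Iff.rfl

/-- R2ᵖ here IS `SlowCore.HeavyTopSlowLaw`. -/
theorem heavyTopSlowLaw_iff_byName :
    HeavyTopSlowLaw ↔ Summit.ValiantsHypothesis.ValiantsHypothesis.Theorems.GrenetZeon.SlowCore.HeavyTopSlowLaw := Iff.rfl

/-! ## The MASS CUT (rev 2): ledger vocabulary (val-idea-26 g5 `MassCut.lean` rev 2, VERBATIM), (b) proved, (c) + glue = the stubs -/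

/-- The linear coefficient of the entry `(i, j)` of the pencil along the direction `v`:  `Σ_c v_c · [x_c] N_ij`. [MassCut] -/
def linEntry {n m : ℕ} (N : AffMat n m) (i j : Fin m) (v : Fin n × Fin n → ℂ) : ℂ :=
  ∑ c, v c * coeff (Finsupp.single c 1) (N i j)

/-- `K` FREEZES the region `R` of the pencil: along every `v ∈ K` the entries in `R` do not move. [MassCut] -/
def Freezes {n m : ℕ} (N : AffMat n m) (R : Fin m → Fin m → Prop) (K : Submodule ℂ (Fin n × Fin n → ℂ)) : Prop :=
  ∀ i j, R i j → ∀ v ∈ K, linEntry N i j v = 0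

/-- **(a) LEDGER ENTRY** (window currency): along `K`, every power `b ≤ n − 1` of `N(x + s v)` has `s`-degree `≤ k` on the block `S × S`. [MassCut] -/
def Ledger (n m : ℕ) (N : AffMat n m) (S : Fin m → Prop) (K : Submodule ℂ (Fin n × Fin n → ℂ)) (k : ℕ) : Prop :=
  ∀ x v : Fin n × Fin n → ℂ, v ∈ K → ∀ b, b ≤ n - 1 → ∀ i j : Fin m, S i → S j →
    (((N.map (lineSubst x v)) ^ b) i j).totalDegree ≤ k

/-- **PRICE** `P` of a whole-pencil certificate: a ledger `(K, k)` on `⊤` with `n·k + codim K ≤ P`. [MassCut] -/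
def RelCert (n m : ℕ) (N : AffMat n m) (P : ℕ) : Prop :=
  ∃ (K : Submodule ℂ (Fin n × Fin n → ℂ)) (k : ℕ), Ledger n m N (fun _ => True) K k ∧ n * k + (n * n - Module.finrank ℂ K) ≤ P

/-- LEVEL CUT (this line's orientation, ✓ `SlowCore.pow_apply_eq_zero_of_lvl_lt`): paths only DROP in level. [MassCut] -/
def LevelCut {n m : ℕ} (N : AffMat n m) (lvl : Fin m → ℕ) : Prop :=
  ∀ i j, lvl i < lvl j → N i j = 0

/-- **(b₀) SHORT-MASS LEDGER, a = 0 form (the one the assembly uses; V27 (q2)/E27-2; MassCut `ShortMassLedger0` verbatim)**: per-level ledgers `kb p` on a COMMON `K` of a level-cut affine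
pencil stack to the whole-pencil ledger `Σ_{p<P} kb p + (P − 1)` on the same `K` — certificates add, `+1` per glue crossing, NO codimension.
(MassCut.lean's general form `ShortMassLedger` carries a near-glue parameter `a` and a `Freezes` hypothesis, giving `⌊(P−1)/(a+1)⌋`, with
✓ `shortMassLedger0_of : ShortMassLedger → ShortMassLedger0`; the S3 assembly needs only this a = 0 form.)  PROVED below (`shortMassLedger0_holds`). -/
def ShortMassLedger0 : Prop :=
  ∀ (n m P : ℕ) (N : AffMat n m), IsAffine N → ∀ lvl : Fin m → ℕ, (∀ i, lvl i < P) → LevelCut N lvl →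
    ∀ (K : Submodule ℂ (Fin n × Fin n → ℂ)) (kb : ℕ → ℕ),
      (∀ p, p < P → Ledger n m N (fun i => lvl i = p) K (kb p)) →
      Ledger n m N (fun _ => True) K ((∑ p ∈ Finset.range P, kb p) + (P - 1))

/-- **(c) LONG-MASS SLOW LAW** (THE research statement of the line after rev 2; `∃ c`, no hand-picked constant): every IRREDUCIBLE nilpotent affine pencil
`B` of size `b` over the `n²` coordinates — a constituent — has a window certificate of PRICE `≤ c·√n·b`, its codim-share of the slow-plane budget.
Trivial menu (freeze: price = mass; absorb: `n(H−1)`) pays unless `c√n/β < b < √n·H/c`; rows U-type / E(n) / E♮(n) / cube-zero / gauge species W(m) ✓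
(crit-7 V27); enemy = Q-RED-2 proper (dense, long, non-triangularisable value space with unstructured off-flag part, no gauge orbit): 0 known members.
NOT weaker than S3 (stronger than S3|Irr, V27 (q1)/R1–R3: the normalisation `c·√n·b` is forced for partition-blind glue and equals the triangular
price); WHY IT MIGHT FAIL: square pencils `m = n` would get price `≤ c·n^{1.5}` where S3 asks only `< n² − n`. [MassCut; crit-7 V27] -/
def LongMassSlowLaw : Prop :=
  ∃ c n₀ : ℕ, ∀ n ≥ n₀, ∀ b : ℕ, ∀ B : AffMat n b, IsAffine B → B ^ b = 0 → pencilAlg B = ⊤ →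
    RelCert n b B (c * (Nat.sqrt n * b))

/-- **GLUE TARGET** `(b) → (c) → S3` (M/L, PROVABLE — kernel debt (g1) composition series + constant conjugation, (g2) Burnside, (g3) conj-invariance ✓,
(g4) constituent `RelCert` ↔ class `Ledger`, (g5) class freeze, (g6) arithmetic `C₀ = (c+14)²`; crit-7 V27 (q3)). [MassCut] -/
def MassCutGlue : Prop := ShortMassLedger0 → LongMassSlowLaw → SlowPlane

/-- **GLUE TARGET, invariant-subspace form** (REV 3): `(b₀) → (c-Inv) → S3`.  PROVED: `massCutGlueInv_holds`. -/
def MassCutGlueInv : Prop := ShortMassLedger0 → Summit.ValiantsHypothesis.ValiantsHypothesis.Theorems.GrenetZeon.SlowCore.LongMassSlowLawInv → SlowPlane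

/-- ✓ **S3 FROM (c-Inv)** — the kernel glue of PART A (`Summit.ValiantsHypothesis.ValiantsHypothesis.Theorems.GrenetZeon.SlowCore.slow_of_longMassSlowLawInv`: small `m` freeze-all; else ✓ `exists_block_conj`
block form, (c) on the big classes transported to class ledgers, coarsened small runs frozen, (b₀) stack, conjugation back, budget `(c+18)²·m² < n³`). -/
theorem slowPlane_of_longMassSlowLawInv (hc : Summit.ValiantsHypothesis.ValiantsHypothesis.Theorems.GrenetZeon.SlowCore.LongMassSlowLawInv) : SlowPlane := by
  obtain ⟨C₀, n₀, h⟩ := Summit.ValiantsHypothesis.ValiantsHypothesis.Theorems.GrenetZeon.SlowCore.slow_of_longMassSlowLawInv hc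
  exact ⟨C₀, n₀, fun n hn m hm N hN hnil => h n hn m hm N hN hnil⟩

/-- ✓ **THE MASS-CUT GLUE HOLDS (Inv form)** — debt (g1)–(g6) of crit-7 g3 V27 (q3) discharged in the kernel (PART A). -/
theorem massCutGlueInv_holds : MassCutGlueInv := fun _ hc => slowPlane_of_longMassSlowLawInv hc

/-- Easy Burnside, line-side copy of ✓ p681255 `SlowCore.irreducibleInv_of_pencilAlg_eq_top` (over this line's `pencilAlg`): a value-invariant
subspace is `pencilAlg`-invariant (`Algebra.adjoin_induction`), and a rank-one matrix moves a nonzero vector anywhere. -/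
theorem irreducibleInv_of_pencilAlg_eq_top {n b : ℕ} (B : AffMat n b) (htop : pencilAlg B = ⊤) :
    Summit.ValiantsHypothesis.ValiantsHypothesis.Theorems.GrenetZeon.SlowCore.IrreducibleInv B := by
  classical
  intro V hV
  have hall : ∀ A : Matrix (Fin b) (Fin b) ℂ, ∀ w ∈ V, A *ᵥ w ∈ V := by
    intro A
    have hA : A ∈ pencilAlg B := by rw [htop]; exact Algebra.mem_top
    refine Algebra.adjoin_induction (p := fun A _ => ∀ w ∈ V, A *ᵥ w ∈ V) ?_ ?_ ?_ ?_ hA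
    · rintro _ ⟨x, rfl⟩ w hw
      exact hV x w hw
    · intro r w hw
      rw [Algebra.algebraMap_eq_smul_one, Matrix.smul_mulVec, Matrix.one_mulVec]
      exact V.smul_mem r hw
    · intro A A' _ _ hA hA' w hw
      rw [Matrix.add_mulVec]
      exact V.add_mem (hA w hw) (hA' w hw)
    · intro A A' _ _ hA hA' w hw
      rw [← Matrix.mulVec_mulVec]
      exact hA _ (hA' w hw)
  by_cases hbot : V = ⊥
  · exact Or.inl hbot
  · right
    obtain ⟨w, hwV, hw0⟩ := (Submodule.ne_bot_iff V).1 hbot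
    obtain ⟨j, hj⟩ : ∃ j, w j ≠ 0 := by
      by_contra h
      push Not at h
      exact hw0 (funext h)
    refine Submodule.eq_top_iff'.2 fun u => ?_
    have hAu : (Matrix.of fun i k => if k = j then u i * (w j)⁻¹ else 0) *ᵥ w = u := by
      ext i
      simp [Matrix.mulVec, dotProduct, ite_mul, Finset.sum_ite_eq', inv_mul_cancel_right₀ hj]
    rw [← hAu]
    exact hall _ w hwV

/-- ✓ **(c-Inv) ⇒ (c)**: the registered Inv-keyed stub implies the `pencilAlg = ⊤`-keyed (c) priced by V27 (easy direction of Burnside;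
Theorems-side ✓ p681255 `SlowCore.longMassSlowLaw_of_inv`); so nothing priced in V27 is lost by the re-keying. -/
theorem longMassSlowLaw_of_inv
    (h : Summit.ValiantsHypothesis.ValiantsHypothesis.Theorems.GrenetZeon.SlowCore.LongMassSlowLawInv) : LongMassSlowLaw := by
  obtain ⟨c, n₀, h⟩ := h
  exact ⟨c, n₀, fun n hn b B hB hnil htop => h n hn b B hB hnil (irreducibleInv_of_pencilAlg_eq_top B htop)⟩

/-- ✓ **(b) HOLDS (a = 0)** — by ✓ `SlowCore.absorb_chain_uniform` (`…SlowCoreAbsorb` rev 3) applied to `M = N(x + s v)`: the level cut survives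
`lineSubst`, affine entries stay affine (`totalDegree_lineSubst_le_one`), and the class ledgers are exactly its per-level window certificates. -/
theorem shortMassLedger0_holds : ShortMassLedger0 := by
  intro n m P N hN lvl hP hcut K kb hkb x v hv b hb i j _ _
  have hbu : ∀ i j, lvl i < lvl j → (N.map (lineSubst x v)) i j = 0 := by
    intro i j hij
    rw [Matrix.map_apply, hcut i j hij, map_zero]
  have haff : ∀ i j, ((N.map (lineSubst x v)) i j).totalDegree ≤ 1 :=
    fun i j => by rw [Matrix.map_apply]; exact totalDegree_lineSubst_le_one x v (hN i j)
  have hk : ∀ b', b' ≤ n - 1 → ∀ i j, lvl i = lvl j → ((((N.map (lineSubst x v)) ^ b') i j).totalDegree ≤ kb (lvl i)) :=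
    fun b' hb' i j hij => hkb (lvl i) (hP i) x v hv b' hb' i j rfl hij.symm
  exact Summit.ValiantsHypothesis.ValiantsHypothesis.Theorems.GrenetZeon.SlowCore.absorb_chain_uniform lvl _ kb (n - 1) P hP hbu
    haff hk b hb i j

/-! ## Stubs (registered targets of the line; `sorry` ONLY here) -/

/-- STUB (c) — **THE LONG-MASS SLOW LAW, invariant-subspace form** `Summit.ValiantsHypothesis.ValiantsHypothesis.Theorems.GrenetZeon.SlowCore.LongMassSlowLawInv` (PART A; val-idea-26 g5 E27-3 twin):
`∃ c n₀, ∀ n ≥ n₀, ∀ b, ∀ B : AffMat n b, IsAffine B → B ^ b = 0 → IrreducibleInv B → RelCert n b B (c * (Nat.sqrt n * b))` — THE ONE RESEARCH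
STATEMENT of the line (REV 3 re-keys (c) from `pencilAlg B = ⊤` to «no common invariant subspace of the values», the form in which ✓ `exists_block_conj`
hands over the constituents; the two are equivalent on paper by BURNSIDE, and this keying keeps Burnside OUT of the kernel glue, which is thereby PROVED —
`massCutGlueInv_holds`).  0 provers head-on (director R315 (3)); ideators supply rows (r1 `relCert_of_flagAdapted`, r2 triangularisable value space,
r3 nil-coupling, r4 gauge); enemy = Q-RED-2 proper on SATURATED (inclusion-maximal) irreducible nilpotent spaces, 0 known members. -/
theorem stub_longMassSlowLawInv : Summit.ValiantsHypothesis.ValiantsHypothesis.Theorems.GrenetZeon.SlowCore.LongMassSlowLawInv := by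
  sorry

/-- STUB ABSORB — CLOSED BY NAME (rev 1): ✓ p674864 `Theorems/GrenetZeonDualUnipotentThreeHalvesSlowCoreAbsorb.lean :: SlowCore.absorb`
(the bytes of record for ABSORB under director R310 (2); credit val-idea-31 g4 (3)); statement = this line's `AbsorbLemma` VERBATIM. -/
theorem stub_absorb : AbsorbLemma :=
  Summit.ValiantsHypothesis.ValiantsHypothesis.Theorems.GrenetZeon.SlowCore.absorb

/-! ## Heads (kernel-checked compositions; no `sorry` below this line) -/

/-- ★ **S3 FROM THE MASS CUT**: `SlowPlane` ⟸ glue (b) (c), with (b) a theorem. -/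
theorem slowPlane_of_massCut (hg : MassCutGlue) (hc : LongMassSlowLaw) : SlowPlane :=
  hg shortMassLedger0_holds hc

/-- ★ **THE SKELETON: THE CRUX BY NAME modulo the ONE registered stub** `stub_longMassSlowLawInv` (S1 ✓ `stub_permRank_of_lineFlat`, S2 ✓ `stub_gms`,
glue ✓ `slowPlane_of_longMassSlowLawInv`, `dualUnipotentThreeHalves_of_slowPlane`). -/
theorem dualUnipotentThreeHalves_of_stubs : DualUnipotentThreeHalves :=
  dualUnipotentThreeHalves_of_slowPlane stub_permRank_of_lineFlat stub_gms (slowPlane_of_longMassSlowLawInv stub_longMassSlowLawInv)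

/-- The same with the two stubs as hypotheses (for citing). -/
theorem dualUnipotentThreeHalves_of_massCut (hg : MassCutGlue) (hc : LongMassSlowLaw) : DualUnipotentThreeHalves :=
  dualUnipotentThreeHalves_of_slowPlane stub_permRank_of_lineFlat stub_gms (slowPlane_of_massCut hg hc)

/-! ### Corollaries kept from rev 1 (R2ᵖ, IRR, RED are CONSEQUENCES of S3; the em-glue stays valid) -/

/-- S3 ⇒ R2ᵖ (drop the heavy-top hypothesis). -/
theorem heavyTopSlowLaw_of_slowPlane (h : SlowPlane) : HeavyTopSlowLaw := by
  obtain ⟨C₀, n₀, h⟩ := h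
  exact ⟨C₀, n₀, fun n hn m hreg N hN hnil _ => h n hn m hreg N hN hnil⟩

/-- R2ᵖ from the mass cut. -/
theorem heavyTopSlowLaw_of_massCut (hg : MassCutGlue) (hc : LongMassSlowLaw) : HeavyTopSlowLaw :=
  heavyTopSlowLaw_of_slowPlane (slowPlane_of_massCut hg hc)

/-- R2ᵖ ⇒ IRR (corollary def of rev 1; drop `pencilAlg N = ⊤`). -/
theorem irrSlowLaw_of_heavyTopSlowLaw (h : HeavyTopSlowLaw) : IrrSlowLaw := by
  obtain ⟨C₀, n₀, h⟩ := h
  exact ⟨C₀, n₀, fun n hn m hreg N hN hnil htop _ => h n hn m hreg N hN hnil htop⟩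

/-- R2ᵖ ⇒ RED (corollary def of rev 1; drop `pencilAlg N ≠ ⊤`). -/
theorem redSlowLaw_of_heavyTopSlowLaw (h : HeavyTopSlowLaw) : RedSlowLaw := by
  obtain ⟨C₀, n₀, h⟩ := h
  exact ⟨C₀, n₀, fun n hn m hreg N hN hnil htop _ => h n hn m hreg N hN hnil htop⟩

/-- **GLUE (rev 1, kept).**  IRR and RED cover every heavy-top pencil (excluded middle on `pencilAlg N = ⊤`; constants = max). -/
theorem heavyTopSlowLaw_of (hI : IrrSlowLaw) (hR : RedSlowLaw) : HeavyTopSlowLaw := by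
  obtain ⟨Ci, ni, hi⟩ := hI
  obtain ⟨Cr, nr, hr⟩ := hR
  refine ⟨max Ci Cr, max ni nr, fun n hn m hreg N hN hnil htop => ?_⟩
  have hregi : Ci * m ^ 2 < n ^ 3 := lt_of_le_of_lt (Nat.mul_le_mul_right _ (le_max_left _ _)) hreg
  have hregr : Cr * m ^ 2 < n ^ 3 := lt_of_le_of_lt (Nat.mul_le_mul_right _ (le_max_right _ _)) hreg
  by_cases hirr : pencilAlg N = ⊤
  · exact hi n (le_trans (le_max_left _ _) hn) m hregi N hN hnil htop hirr
  · exact hr n (le_trans (le_max_right _ _) hn) m hregr N hN hnil htop hirr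

/-- **R2 ⇒ R2ᵖ** (✓ `runBound`: flag-cheap ⇒ slow).  The converse fails («slow only by cancellation» — E(n)). -/
theorem heavyTopSlowLaw_of_heavyTopLaw (h : HeavyTopLaw) : HeavyTopSlowLaw := by
  obtain ⟨C₀, n₀, h⟩ := h
  exact ⟨C₀, n₀, fun n hn m hreg N hN hnil htop => runBound_proof n m N (h n hn m hreg N hN hnil htop)⟩

/-- **S3 from R1 + R2ᵖ** (rev 1 head, kept). -/
theorem slowPlane_of_split (hR1 : RadicalCoarsening) (hR2 : HeavyTopSlowLaw) : SlowPlane := by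
  obtain ⟨C₀, n₀, h⟩ := hR2
  refine ⟨C₀, n₀, fun n hn m hm N hN hnil => ?_⟩
  by_cases hK : ∃ K : Submodule ℂ (Fin n × Fin n → ℂ),
      RadOrth n m N K ∧ 16 * m * Nat.sqrt n + 16 * n < Module.finrank ℂ K
  · obtain ⟨K, hK1, hK2⟩ := hK
    exact runBound_proof n m N (hR1 n m N hN K hK1 hK2)
  · push Not at hK
    exact h n hn m hm N hN hnil hK

/-- The crux from R2ᵖ alone (rev 1 head, kept). -/
theorem dualUnipotentThreeHalves_of (hR2 : HeavyTopSlowLaw) : DualUnipotentThreeHalves :=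
  dualUnipotentThreeHalves_of_slowPlane stub_permRank_of_lineFlat stub_gms (slowPlane_of_split stub_radicalCoarsening hR2)

/-! ## Wiring of record (kernel): IRR ⟸ idea-26's `IndexCoreLaw` -/

/-- **IRR from the INDEX-CORE LAW** (✓ p670964 `flagCheap_of_indexCoreLaw` + ✓ `runBound`; the heavy-top hypothesis is not even used). -/
theorem irrSlowLaw_of_indexCoreLaw
    (h : Summit.ValiantsHypothesis.ValiantsHypothesis.Theorems.GrenetZeon.IndexCore.IndexCoreLaw) : IrrSlowLaw := by
  obtain ⟨C₀, n₀, hC⟩ :=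
    Summit.ValiantsHypothesis.ValiantsHypothesis.Theorems.GrenetZeon.IndexCore.flagCheap_of_indexCoreLaw h
  exact ⟨C₀, n₀, fun n hn m hreg N hN hnil _ hirr => runBound_proof n m N (hC n hn m hreg N hN hnil hirr)⟩

end Summit.ValiantsHypothesis.ValiantsHypothesis.Cruxes.DualUnipotentThreeHalves.SlowCoreLine

end
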